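import Summits.CriticalPhenomena.PercolationContinuityZ3.Theorems.PercNearOneGluingNoHeavyPcintNawRandCounting
import HarnessLib

/-!
# PCINT lane, reduction B2r: `θ^site(p) ≤ Σ_{γ NAW} p^{n+1} q^{gapTotal γ} ((1+q)/2)^{cornerTotal γ}`

Cell `prim-pcint`, seat `prim-pcint-2`; memo `run/shared/lean/prim/pcint/REDUCTIONS.md` §B2r.2, §B2r.6.
Does NOT build on p205010.

AVERAGING over the uniform choice of the sibling orders `o` (independent permutations of the directions at the
prefix nodes; distinct corners of one word read distinct nodes): `Σ_o q^{#bad corners} = #Orders ·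
((1+q)/2)^{cornerTotal}` exactly (`sum_orders_pow_card_badTimes`; a swap involution on permutations gives the
factor `1/2`).  With the forcing (`…NawRandForcing`) and counting (`…NawRandCounting`) this is the reduction of
certificate kind `nawrand_cw` (`siteTheta_le_sum_nawRandWeight`) and its certificate glue
(`le_siteCriticalProb_zd_of_nawRand_le_geometric`).  The lane's two-implementation certificates of this kind:
`p_c^site(ℤ³) ≥ 0.25112`, `p_c^site(ℤ⁴) ≥ 0.16892`, `p_c^site(ℤ⁵) ≥ 0.12625`.
-/

noncomputable section

namespace Summit.CriticalPhenomena.PercolationContinuityZ3.Theorems.Pcint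

open Finset MeasureTheory Literature.Probability.Percolation Literature.Probability.LatticeModels

variable {d n : ℕ}

/-! ### Averaging over the sibling orders -/

/-- The corner factor read through `o` is `q` on bad corners and `1` otherwise. [folklore] -/
theorem cornerFactor_eq_ite (q : ℝ) (o : Orders d n) (γ : Fin n → Fin d × Bool) (s : Fin n)
    [Decidable (IsBad o γ s)] :
    cornerFactor q γ s (o (pnode γ s)) = if IsBad o γ s then q else 1 := by
  obtain ⟨k, hk⟩ := s
  unfold cornerFactor IsBad
  dsimp only
  by_cases h : k + 2 ≤ n
  · rw [dif_pos h]
    by_cases hlt : dirCode (o (pnode γ ⟨k, hk⟩) (γ ⟨k + 1, by omega⟩)) <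
        dirCode (o (pnode γ ⟨k, hk⟩) (γ ⟨k, hk⟩))
    · rw [if_pos hlt, if_pos ⟨h, hlt⟩]
    · rw [if_neg hlt, if_neg fun hh => hlt hh.2]
  · rw [dif_neg h, if_neg fun hh => h hh.1]

/-- `q^{#bad corners}` as a product of corner factors. [folklore] -/
theorem prod_cornerFactor_eq (q : ℝ) (o : Orders d n) (γ : Fin n → Fin d × Bool) :
    ∏ s ∈ cornerTimes γ, cornerFactor q γ s (o (pnode γ s)) = q ^ (badTimes o γ).card := by
  classical
  rw [badTimes, ← prod_const, prod_filter]
  exact prod_congr rfl fun s _ => cornerFactor_eq_ite q o γ s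

/-- **The coin of a corner is fair**: over all permutations `σ` of a finite type, `f (σ b) < f (σ a)`
holds for exactly half of them (`a ≠ b`, `f` injective), so `Σ_σ (q if so, else 1) = #Perm · (1+q)/2`
(swap involution `σ ↦ swap(σ a, σ b) ∘ σ`). [folklore] -/
theorem sum_perm_cornerCoin {α : Type*} [Fintype α] [DecidableEq α] (q : ℝ) (f : α → ℕ)
    (hf : Function.Injective f) {a b : α} (hab : a ≠ b) :
    ∑ σ : Equiv.Perm α, (if f (σ b) < f (σ a) then q else 1) =
      Fintype.card (Equiv.Perm α) * ((1 + q) / 2) := by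
  set g : Equiv.Perm α → ℝ := fun σ => if f (σ b) < f (σ a) then q else 1 with hg
  set ι : Equiv.Perm α → Equiv.Perm α := fun σ => σ.trans (Equiv.swap (σ a) (σ b)) with hι
  have hιa : ∀ σ, ι σ a = σ b := fun σ => by simp [hι, Equiv.swap_apply_left]
  have hιb : ∀ σ, ι σ b = σ a := fun σ => by simp [hι, Equiv.swap_apply_right]
  have hinv : Function.Involutive ι := by
    intro σ
    ext x
    rw [show ι (ι σ) x = Equiv.swap (ι σ a) (ι σ b) (ι σ x) from rfl, hιa, hιb,
      show ι σ x = Equiv.swap (σ a) (σ b) (σ x) from rfl, Equiv.swap_comm (σ b) (σ a),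
      Equiv.swap_apply_self]
  have hsum : ∑ σ, g (ι σ) = ∑ σ, g σ :=
    Fintype.sum_equiv (hinv.toPerm ι) (fun σ => g (ι σ)) g fun _ => rfl
  have hpair : ∀ σ, g σ + g (ι σ) = 1 + q := by
    intro σ
    have hne : f (σ a) ≠ f (σ b) := fun h => hab (σ.injective (hf h))
    simp only [hg, hιa, hιb]
    rcases lt_or_gt_of_ne hne with h | h
    · rw [if_neg (not_lt.2 h.le), if_pos h]
    · rw [if_pos h, if_neg (not_lt.2 h.le), add_comm]
  have h2 : ∑ σ, g σ + ∑ σ, g (ι σ) = ∑ _σ : Equiv.Perm α, (1 + q) := by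
    rw [← sum_add_distrib]
    exact sum_congr rfl fun σ _ => hpair σ
  rw [hsum, sum_const, card_univ, nsmul_eq_mul] at h2
  show ∑ σ, g σ = _
  linarith

/-- Prefix nodes determine their length: `pnode γ` is injective. [folklore] -/
theorem pnode_injective (γ : Fin n → Fin d × Bool) : Function.Injective (pnode γ) :=
  fun _ _ h => congrArg Sigma.fst h

/-- **Averaging.** `Σ_o q^{#badTimes o γ} = #Orders · ((1+q)/2)^{cornerTotal γ}`: the bad-corner
indicators of one word read independent uniformly random permutations at distinct prefix nodes.
[folklore] -/
theorem sum_orders_pow_card_badTimes (q : ℝ) (γ : Fin n → Fin d × Bool) :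
    ∑ o : Orders d n, q ^ (badTimes o γ).card =
      Fintype.card (Orders d n) * ((1 + q) / 2) ^ cornerTotal γ := by
  classical
  set CT := cornerTimes γ with hCT
  set Φ : PNode d n → Equiv.Perm (Fin d × Bool) → ℝ :=
    fun u σ => ∏ s ∈ CT.filter (fun s => pnode γ s = u), cornerFactor q γ s σ with hΦ
  have h1 : ∀ o : Orders d n, q ^ (badTimes o γ).card = ∏ u, Φ u (o u) := by
    intro o
    rw [← prod_cornerFactor_eq, ← prod_fiberwise CT (pnode γ)]
    refine prod_congr rfl fun u _ => prod_congr rfl fun s hs => ?_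
    rw [(mem_filter.1 hs).2]
  have h2 : ∀ u, ∑ σ, Φ u σ = Fintype.card (Equiv.Perm (Fin d × Bool)) *
      (if u ∈ CT.image (pnode γ) then (1 + q) / 2 else 1) := by
    intro u
    by_cases hu : u ∈ CT.image (pnode γ)
    · rw [if_pos hu]
      obtain ⟨s₀, hs₀, rfl⟩ := mem_image.1 hu
      have hfilter : CT.filter (fun s => pnode γ s = pnode γ s₀) = {s₀} := by
        ext s
        rw [mem_filter, mem_singleton]
        constructor
        · rintro ⟨-, h⟩; exact pnode_injective γ h
        · rintro rfl; exact ⟨hs₀, rfl⟩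
      simp only [hΦ, hfilter, prod_singleton]
      obtain ⟨h, hperp, -, -⟩ := mem_cornerTimes.1 hs₀
      have hab : γ ⟨s₀, by omega⟩ ≠ γ ⟨s₀ + 1, by omega⟩ := fun he => hperp (congrArg Prod.fst he)
      simp only [cornerFactor, dif_pos h]
      exact sum_perm_cornerCoin q dirCode dirCode_injective hab
    · rw [if_neg hu, mul_one]
      have hfilter : CT.filter (fun s => pnode γ s = u) = ∅ := by
        rw [filter_eq_empty_iff]
        intro s hs he
        exact hu (mem_image.2 ⟨s, hs, he⟩)
      simp only [hΦ, hfilter, prod_empty, sum_const, card_univ, nsmul_eq_mul, mul_one]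
  simp_rw [h1]
  rw [← Fintype.prod_sum]
  simp_rw [h2]
  rw [prod_mul_distrib, prod_const, card_univ, prod_ite_mem, univ_inter, prod_const,
    card_image_of_injective _ (pnode_injective γ), Fintype.card_fun, cornerTotal, hCT]
  push_cast
  ring

/-! ### The reduction -/

/-- For every family of sibling orders: `θ^site(p) ≤ Σ_{γ NAW} p^{n+1} (1-p)^{#forcedSites o γ}`.
[folklore] -/
theorem siteTheta_le_sum_nawRandEvent (p : unitInterval) (o : Orders d n) :
    siteTheta (zdGraph d) 0 p ≤ ∑ γ ∈ (sawWords d n).filter (fun w => chordEdges w = ∅),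
      (p : ℝ) ^ (n + 1) * (1 - p : ℝ) ^ (forcedSites o γ).card := by
  classical
  set μ := sitePercolation (Site d) p with hμ
  set NW := (sawWords d n).filter fun w => chordEdges w = ∅ with hNW
  calc siteTheta (zdGraph d) 0 p = μ.real (sitePercolatesAt (zdGraph d) 0) := rfl
    _ ≤ μ.real (⋃ γ ∈ NW, nawRandEvent o γ) :=
        measureReal_mono (sitePercolatesAt_subset_biUnion_nawRandEvent o) (measure_ne_top μ _)
    _ ≤ ∑ γ ∈ NW, μ.real (nawRandEvent o γ) := measureReal_biUnion_finset_le _ _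
    _ = ∑ γ ∈ NW, (p : ℝ) ^ (n + 1) * (1 - p : ℝ) ^ (forcedSites o γ).card :=
        sum_congr rfl fun γ hγ => by
          rw [hμ, nawRandEvent_real p o (mem_sawWords.1 (mem_filter.1 hγ).1)]

/-- **Reduction B2r** (certificate kind `nawrand_cw`).  For `0 ≤ q ≤ 1` with `q^{2d-1} ≥ 1 - p`:
`θ^site(p) ≤ Σ_{γ ∈ NAW_n} p^{n+1} · q^{gapTotal γ} · ((1+q)/2)^{cornerTotal γ}` for every `n`.
[folklore] -/
theorem siteTheta_le_sum_nawRandWeight (d n : ℕ) (p : unitInterval) {q : ℝ} (hq0 : 0 ≤ q)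
    (hq1 : q ≤ 1) (hpq : 1 - (p : ℝ) ≤ q ^ (2 * d - 1)) :
    siteTheta (zdGraph d) 0 p ≤
      ∑ γ ∈ (sawWords d n).filter (fun w => chordEdges w = ∅), nawRandWeight p q γ := by
  classical
  set NW := (sawWords d n).filter fun w => chordEdges w = ∅ with hNW
  have hp1 : 0 ≤ 1 - (p : ℝ) := sub_nonneg.2 p.2.2
  have ho : ∀ o : Orders d n, siteTheta (zdGraph d) 0 p ≤
      ∑ γ ∈ NW, (p : ℝ) ^ (n + 1) * q ^ gapTotal γ * q ^ (badTimes o γ).card := by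
    intro o
    refine (siteTheta_le_sum_nawRandEvent p o).trans (sum_le_sum fun γ hγ => ?_)
    have hγ' : IsSAW γ := mem_sawWords.1 (mem_filter.1 hγ).1
    rw [mul_assoc, ← pow_add, ← card_chargedPairs]
    exact mul_le_mul_of_nonneg_left (pow_card_forcedSites_le hγ' hp1 hq0 hq1 hpq) (pow_nonneg p.2.1 _)
  have hO : (0 : ℝ) < Fintype.card (Orders d n) := Nat.cast_pos.2 Fintype.card_pos
  have hsum := sum_le_sum fun (o : Orders d n) (_ : o ∈ univ) => ho o
  rw [sum_const, card_univ, nsmul_eq_mul, sum_comm] at hsum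
  have key : ∑ γ ∈ NW, ∑ o : Orders d n, (p : ℝ) ^ (n + 1) * q ^ gapTotal γ * q ^ (badTimes o γ).card
      = Fintype.card (Orders d n) * ∑ γ ∈ NW, nawRandWeight p q γ := by
    rw [mul_sum]
    refine sum_congr rfl fun γ _ => ?_
    rw [← mul_sum, sum_orders_pow_card_badTimes, nawRandWeight]
    ring
  rw [key] at hsum
  exact le_of_mul_le_mul_left hsum hO

/-! ### Certificate glue -/

/-- **Certificate glue (B2r).** If `Σ_{γ ∈ NAW_n} nawRandWeight p q γ ≤ C rⁿ` for all `n` with `r < 1`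
(a Collatz–Wielandt certificate for a window automaton dominating the weight, REDUCTIONS.md §R2, §B2r.6),
then `θ^site(p) = 0`. [folklore] -/
theorem siteTheta_zd_eq_zero_of_nawRand_le_geometric (d : ℕ) (p : unitInterval) {q C r : ℝ}
    (hq0 : 0 ≤ q) (hq1 : q ≤ 1) (hpq : 1 - (p : ℝ) ≤ q ^ (2 * d - 1)) (hr0 : 0 ≤ r) (hr : r < 1)
    (h : ∀ n, ∑ γ ∈ (sawWords d n).filter (fun w => chordEdges w = ∅), nawRandWeight p q γ ≤ C * r ^ n) :
    siteTheta (zdGraph d) 0 p = 0 := by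
  have ht : Filter.Tendsto (fun n : ℕ => C * r ^ n) Filter.atTop (nhds 0) := by
    simpa using (tendsto_pow_atTop_nhds_zero_of_lt_one hr0 hr).const_mul C
  exact le_antisymm (ge_of_tendsto' ht fun n =>
    (siteTheta_le_sum_nawRandWeight d n p hq0 hq1 hpq).trans (h n)) measureReal_nonneg

/-- **Certificate glue (B2r), threshold form**: under the same hypothesis, `p ≤ p_c^site(ℤ^d)`.
[folklore] -/
theorem le_siteCriticalProb_zd_of_nawRand_le_geometric (d : ℕ) (p : unitInterval) {q C r : ℝ}
    (hq0 : 0 ≤ q) (hq1 : q ≤ 1) (hpq : 1 - (p : ℝ) ≤ q ^ (2 * d - 1)) (hr0 : 0 ≤ r) (hr : r < 1)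
    (h : ∀ n, ∑ γ ∈ (sawWords d n).filter (fun w => chordEdges w = ∅), nawRandWeight p q γ ≤ C * r ^ n) :
    (p : ℝ) ≤ siteCriticalProb (zdGraph d) 0 := by
  have h0 := siteTheta_zd_eq_zero_of_nawRand_le_geometric d p hq0 hq1 hpq hr0 hr h
  refine le_csInf ⟨1, Or.inr rfl⟩ ?_
  rintro r (⟨hr, hθ⟩ | hr)
  · by_contra hlt
    push Not at hlt
    have hmono := siteTheta_mono (G := zdGraph d) (0 : Site d)
      (show (⟨r, hr⟩ : unitInterval) ≤ p from hlt.le)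
    exact hθ.not_ge (hmono.trans_eq h0)
  · rw [Set.mem_singleton_iff] at hr
    rw [hr]
    exact p.2.2

end Summit.CriticalPhenomena.PercolationContinuityZ3.Theorems.Pcint
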